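import Summits.CriticalPhenomena.PercolationContinuityZ3.Theorems.PercNearOneGluingNoHeavySamePContinuation
import Literature.Barriers.CriticalPhenomena.SubexponentialGrowthZdUniqueness
import HarnessLib

/-!
# The same-`p` witness input `SamePWitness G x` and the conditional closing theorem for
# Benjamini–Schramm's Conjecture 4 (lane `prim-bschramm`, seat p4, class C3)

builds on p205010 (kernel theorem, internal audit signed; external expert review pending).
New statements of the lane (targets), not published facts.  See `run/shared/lean/prim/bschramm/P4-GENERAL.md`.

`SamePWitness G x` — INPUT (FSW) of the memo: at every density `p` at which `x` percolates there is a
history-driven site-renormalisation scheme on `G` (the tree's abstract form of Kozma–Nitzan's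
exploration process, `HSiteScheme`), lawful at `(p, ε)` with `ε < 2⁻³²`, with uniformly bounded probe
envelopes and initial edges in `E(G)`, whose infinite macro-cluster forces `x ↔ ∞`.  By the continuation
principle (`SameP.theta_criticalProb_eq_zero_of_schemes`) it implies `θ_x(p_c(G, x)) = 0` on ANY graph with
countably many vertices — no transitivity, amenability or growth hypothesis is needed for THIS step; those
enter only in CONSTRUCTING the witness (Kozma–Nitzan §4: near-one gluing = the tree's `AdditiveGluing`,
a.s. uniqueness of the infinite cluster, and the box geometry of the graph).

* `SamePWitness` — the input, as a `Prop`-valued predicate of a rooted graph;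
* `theta_criticalProb_eq_zero_of_samePWitness` — INPUT ⇒ no percolation at criticality at `x`;
* `conj4_residue_of_samePWitness` — the open residue of Conj. 4 (amenable quasi-transitive graphs, the
  tree's binder shape of `BenjaminiLyonsPeresSchramm1999_noCriticalPercolation`) follows from the input at
  every vertex.
[cite: KozmaNitzan2024, §1 p. 2 (approach 1)] [cite: BenjaminiSchramm1996, Conj. 4]
-/

noncomputable section

namespace Summit.CriticalPhenomena.PercolationContinuityZ3.Theorems

open MeasureTheory Literature.Probability.Percolation Literature.Probability.LatticeModels
open Literature.Barriers.CriticalPhenomena (IsQuasiTransitive IsGraphAmenable)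

namespace SameP

variable {V : Type*}

/-- **INPUT (FSW) — same-`p` finite-range witnesses of percolation at `x`.**  At every density `p` with
`θ_x(p) > 0` there is a history-driven site-renormalisation scheme `S` on `G`, lawful at `(p, ε)` for some
`ε < 2⁻³²`, all of whose probe envelopes have at most `N` edges, with `U₀ ⊆ E(G)`, and such that on the
initial event an infinite final macro-cluster forces `x ↔ ∞` (up to the null set `{ω ⊄ E(G)}`).
(For `G = ℤ^d`, `d ≥ 3`: Kozma–Nitzan §4 from Conjecture 3, `SameP.exists_KSch_lawful` +
`SameP.card_env_le_of_next` + `KSch.mem_percolatesVia_of_infinite`.) [cite: KozmaNitzan2024, §4 p. 25 (Definition of an exploration process)] -/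
def SamePWitness (G : SimpleGraph V) (x : V) : Prop :=
  ∀ p : unitInterval, 0 < theta G x p →
    ∃ (S : HSiteScheme V) (ε : ℝ) (N : ℕ), S.Lawful G p ε ∧ ε < (1 / 2) ^ 32 ∧
      (∀ h P, S.E.next h = some P → P.env.card ≤ N) ∧ (↑S.U₀ : Set (Sym2 V)) ⊆ G.edgeSet ∧
      S.initEvent ∩ {ω | (S.occFinal ω).Infinite} ⊆ percolatesAt x ∪ {ω | ¬ω ⊆ G.edgeSet}

/-- **INPUT ⇒ no percolation at criticality** (any graph with countably many vertices).
[cite: KozmaNitzan2024, §1 p. 2 (approach 1)] -/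
theorem theta_criticalProb_eq_zero_of_samePWitness [Countable V] (G : SimpleGraph V) (x : V)
    (h : SamePWitness G x) : theta G x ⟨criticalProb G x, criticalProb_mem_Icc G x⟩ = 0 :=
  theta_criticalProb_eq_zero_of_schemes G x h

/-- **The open residue of Benjamini–Schramm's Conjecture 4, conditionally**: for a connected, locally
finite, quasi-transitive AMENABLE graph (the class not covered by BLPS 1999 / Hutchcroft 2016, where the
infinite cluster is a.s. unique at every density by Burton–Keane, `BurtonKeane1989_atMostOneInfiniteCluster_holds`),
same-`p` witnesses at every vertex give `θ_x(p_c(G, x)) = 0` for every `x` — in the binder shape of the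
tree's in-print cases (`Hutchcroft2016_noPercolationAtCriticality`, `BenjaminiLyonsPeresSchramm1999_noCriticalPercolation`).
The hypotheses `Connected`, `IsQuasiTransitive`, `IsGraphAmenable` are not used by the proof (the
continuation principle is graph-general); they delimit the class in which the witness is to be built.
[cite: BenjaminiSchramm1996, Conj. 4] -/
theorem conj4_residue_of_samePWitness {V : Type} [DecidableEq V] [Countable V] (G : SimpleGraph V)
    [G.LocallyFinite] (_hc : G.Connected) (_hq : IsQuasiTransitive G) (_ha : IsGraphAmenable G)
    (h : ∀ x : V, SamePWitness G x) (x : V) :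
    theta G x ⟨criticalProb G x, criticalProb_mem_Icc G x⟩ = 0 :=
  theta_criticalProb_eq_zero_of_samePWitness G x (h x)

end SameP

end Summit.CriticalPhenomena.PercolationContinuityZ3.Theorems

end
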